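import Summits.ResolutionOfSingularities.ResolutionOfSingularities.Theorems.FrobeniusLadderFRationalResolutionIsolatedAffineLogRegularChartResolution
import Summits.ResolutionOfSingularities.ResolutionOfSingularities.Theorems.FrobeniusLadderFRationalResolutionSimplicialNormalization
import Summits.ResolutionOfSingularities.ResolutionOfSingularities.Theorems.FrobeniusLadderFRationalResolutionFixedChart
import Summits.ResolutionOfSingularities.ResolutionOfSingularities.Theorems.FrobeniusLadderFRationalResolutionDiagQuotientSurface
import HarnessLib

/-!
# Crux `FrobeniusLadder.FRationalResolution` (stmt-ResolutionOfSingularities-15317), line `redirect`,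
# stub `stub_diagonalizableQuotientResolution` — **ISOLATED (tame) diagonalizable quotient singularities over an
# algebraically closed field ARE RESOLVABLE** (the isolated-singularity case of the stub over `K = K̄`, assembled)

End of lineage leafhand-4's isolated-singularity lane. At a `D(A)`-FIXED point `𝔔` of a quotient chart
`φ : Spec S₀ → X` (`S` regular of finite type over `K`, graded by the finite abelian group `A`, `S₀ = 𝒮 0`):
`…FixedPointLogRegularNhd.exists_nhd_isLogRegularAt_of_fixed` gives the monomial chart `x^m`, `m ∈ ℤⁿ_{≥0} ⊓ ker`,
Kato-log-regular on a basic open `D(g) ∋ 𝔮 = 𝔔 ∩ S₀` with `n = dim S_𝔔`; `…SimplicialNormalization.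
exists_normalized_chart_forall_isPrimSimplicial` (✓ p824855) re-parametrises it to an fs SPANNING chart with PRIMITIVELY
SIMPLICIAL face fan; its unit face is `0` (`x^m ∈ 𝔔` for `m ≠ 0`); `…FixedPointDimension` gives `dim (S₀)_𝔮 = n`. These
are exactly the ring data of `…IsolatedAffineLogRegularChartResolution.hasResolution_of_isolated_affine_logRegular_charts_
of_isAlgClosed` (✓ p824766, which derives closedness, punctured regularity and non-regularity of the fan and feeds (ε₂′)
✓ p824253: `𝔮`-primary monomial centre, Kato (10.4) chart, E-k over `K̄`). In the TAME case every point under a quotient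
chart is under a fixed point of another one (`…FixedChart.exists_fixed_chart` ✓ p817830).

* `hasResolution_of_isolated_fixedPoint_charts_of_isAlgClosed` — `X` integral, locally of finite type over `K = K̄`,
  finitely many singular points, each the image of a `D(A)`-FIXED point of a quotient chart ⇒ `Scheme.HasResolution X`;
* **`hasResolution_of_isolated_tame_quotient_charts_of_isAlgClosed`** — the stub's hypothesis `hq` AT THE SINGULAR POINTS,
  with `|A| ∈ Kˣ` (tame) chartwise, `K` algebraically closed and finitely many singular points ⇒ `Scheme.HasResolution X`.

Honest label: the ISOLATED + TAME + `K = K̄` case of `stub_diagonalizableQuotientResolution` (no stub closed by name: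
the stub allows any field, wild `A` and non-isolated singularities — general case = functorial toroidal resolution /
Bergh–Rydh destackification). No definitions, no named facts, no sorry.
[cite: Kato1994, Def. (2.1), (10.4)] [cite: KempfEtAl1973, Ch. I §2 Thm. 11] [cite: Kollar2007, §2.2]
[folklore; cite: SGA1, Exp. I Prop. 7.6; SGA3, Exp. VIII §4–5]
-/

noncomputable section

-- single-problem summit: the doubled namespace component is forced
set_option linter.dupNamespace false

open CategoryTheory AlgebraicGeometry
open Literature.AlgebraicGeometry.Resolution Literature.Geometry.PolyhedralFans
open Literature.AlgebraicGeometry.Resolution.LogBlowup Literature.AlgebraicGeometry.Resolution.LogChart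
open Literature.AlgebraicGeometry.Resolution.DiagonalizableQuotient
open Summit.ResolutionOfSingularities.ResolutionOfSingularities.Theorems.FRationalResolution

namespace Summit.ResolutionOfSingularities.ResolutionOfSingularities.Theorems.FRationalResolution.IsolatedFixedPointResolution

/-- **Isolated singularities over `K = K̄` lying under `D(A)`-fixed points of quotient charts are resolvable.** Let `X` be
integral, locally of finite type over an algebraically closed field `K`, with finitely many singular points, each of
which is `φ v` for an étale `φ : Spec S₀ → X` where `S` is a regular `K`-algebra of finite type graded by a finite abelian
group `A`, `S₀ = 𝒮 0`, and `v = 𝔔 ∩ S₀` for a prime `𝔔 ⊇ S_c` (`c ≠ 0`) of `S` (a `D(A)`-fixed point). Then `X` has a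
resolution of singularities. [cite: Kato1994, Def. (2.1), (10.4)] [cite: Kollar2007, §2.2] -/
theorem hasResolution_of_isolated_fixedPoint_charts_of_isAlgClosed (K : Type) [Field K] [IsAlgClosed K]
    (X : Scheme.{0}) [IsIntegral X] (f : X ⟶ Spec (.of K)) [LocallyOfFiniteType f]
    (hfin : (Scheme.regularLocus X)ᶜ.Finite)
    (hchart : ∀ x : X, x ∉ Scheme.regularLocus X →
      ∃ (A : Type) (_ : AddCommGroup A) (_ : Finite A) (_ : DecidableEq A)
        (S : Type) (_ : CommRing S) (_ : Algebra K S) (𝒮 : A → Submodule K S) (_ : GradedAlgebra 𝒮),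
        Algebra.FiniteType K S ∧ IsRegularRing S ∧
        ∃ (φ : Spec (.of (𝒮 0)) ⟶ X), Etale φ ∧
          ∃ (v : Spec (.of (𝒮 0))) (𝔔 : Ideal S) (_ : 𝔔.IsPrime),
            𝔔.comap (algebraMap (𝒮 0) S) = v.asIdeal ∧ (∀ c : A, c ≠ 0 → ∀ s ∈ 𝒮 c, s ∈ 𝔔) ∧ φ v = x) :
    Scheme.HasResolution X := by
  classical
  refine IsolatedAffineLogRegularChartResolution.hasResolution_of_isolated_affine_logRegular_charts_of_isAlgClosed
    K X f hfin fun x hx => ?_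
  obtain ⟨A, _, _, _, S, _, _, 𝒮, _, hft, hregS, φ, hφ, v, 𝔔, h𝔔, h𝔔v, hfix, hvx⟩ := hchart x hx
  haveI := hft
  haveI := hregS
  haveI := hφ
  haveI := h𝔔
  obtain ⟨I, hI⟩ := v
  simp only at h𝔔v
  subst h𝔔v
  have hA : AddMonoid.IsTorsion A := fun c => isOfFinAddOrder_of_finite c
  -- the fixed-point monomial chart, log regular on `D(g)`
  obtain ⟨n, xs, a, hxa, hn, φ₀, hφ₀, g, hg𝔔, hreg⟩ :=
    FixedPointLogRegularNhd.exists_nhd_isLogRegularAt_of_fixed 𝒮 hA 𝔔 hfix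
  have ha : ∀ i, IsOfFinAddOrder (a i) := fun i => hA (a i)
  -- its normalisation, with primitively simplicial face fan
  obtain ⟨P', e, hfg, hsat, hspan, hiff, hps⟩ :=
    SimplicialNormalization.exists_normalized_chart_forall_isPrimSimplicial a ha φ₀
  set 𝔮 : Ideal (𝒮 0) := 𝔔.comap (algebraMap (𝒮 0) S) with h𝔮
  let ψ : Multiplicative P' →* 𝒮 0 := φ₀.comp (AddMonoidHom.toMultiplicative e.toAddMonoidHom)
  -- unit face `0`
  have hfix' : ∀ p : P', (p : Fin n → ℤ) ≠ 0 → ψ (Multiplicative.ofAdd p) ∈ 𝔮 := by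
    intro p hp
    have hPnonneg : (0 : Fin n → ℤ) ≤ ((e p) : Fin n → ℤ) :=
      AddSubmonoid.mem_nonneg.mp (AddSubmonoid.mem_inf.mp (e p).2).1
    have hep : ((e p) : Fin n → ℤ) ≠ 0 := fun h0 => hp (by
      have h1 : e p = 0 := Subtype.ext h0
      have h2 : p = 0 := (map_eq_zero_iff e e.injective).mp h1
      rw [h2]; rfl)
    obtain ⟨i, hi⟩ : ∃ i, ((e p) : Fin n → ℤ) i ≠ 0 := by
      by_contra hall
      push Not at hall
      exact hep (funext hall)
    have hpos : 1 ≤ (((e p) : Fin n → ℤ) i).toNat := by have := hPnonneg i; simp only [Pi.zero_apply] at this; omega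
    change ((φ₀ (Multiplicative.ofAdd (e p)) : 𝒮 0) : S) ∈ 𝔔
    rw [hφ₀, ← Finset.mul_prod_erase Finset.univ _ (Finset.mem_univ i)]
    exact Ideal.mul_mem_right _ _ (Ideal.pow_mem_of_mem 𝔔 (hxa i).1 _ hpos)
  -- `dim (S₀)_𝔮 = dim S_𝔔 = n`
  letI : Algebra (Localization.AtPrime 𝔮) (Localization.AtPrime 𝔔) :=
    (Localization.localRingHom 𝔮 𝔔 (algebraMap (𝒮 0) S) rfl).toAlgebra
  haveI : IsScalarTower (𝒮 0) (Localization.AtPrime 𝔮) (Localization.AtPrime 𝔔) :=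
    IsScalarTower.of_algebraMap_eq fun r => by
      rw [IsScalarTower.algebraMap_apply (𝒮 0) S (Localization.AtPrime 𝔔)]
      exact (Localization.localRingHom_to_map 𝔮 𝔔 (algebraMap (𝒮 0) S) rfl r).symm
  have hdim : ringKrullDim (Localization.AtPrime 𝔮) = n := by
    rw [FixedPointDimension.ringKrullDim_atPrime_eq_of_fixed 𝒮 hA 𝔔 hfix
      (Localization.AtPrime 𝔮) (Localization.AtPrime 𝔔), ← hn]
  -- assemble the affine chart data
  refine ⟨CommRingCat.of (𝒮 0), φ, inferInstance, ⟨𝔮, hI⟩, hvx, n, P', hfg,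
    (fun w m hm hmw => (hsat hmw).resolve_left (Nat.pos_iff_ne_zero.mp hm)), hspan, ψ, g, ?_, ?_, hfix', hdim, hps⟩
  · show g ∉ 𝔮
    rw [h𝔮, Ideal.mem_comap]
    exact hg𝔔
  · intro 𝔭 h𝔭 hg𝔭
    exact (@hiff 𝔭 h𝔭).mpr (@hreg 𝔭 h𝔭 hg𝔭)

/-- **Isolated TAME diagonalizable quotient singularities over an algebraically closed field are resolvable.** Let `X`
be integral, locally of finite type over an algebraically closed field `K`, with finitely many singular points, each of
which lies in the image of an étale `K`-morphism `Spec S₀ → X` with `S` a REGULAR `K`-algebra of finite type graded by a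
finite abelian group `A` of order invertible in `K` and `S₀ = 𝒮 0` (the hypothesis `hq` of
`stub_diagonalizableQuotientResolution`, at the singular points, in the tame case). Then `X` has a resolution of
singularities. [cite: Kato1994, (10.4)] [cite: Kollar2007, §2.2] [folklore; cite: SGA1, Exp. I Prop. 7.6; SGA3, Exp. VIII §4–5] -/
theorem hasResolution_of_isolated_tame_quotient_charts_of_isAlgClosed (K : Type) [Field K] [IsAlgClosed K]
    (X : Scheme.{0}) [IsIntegral X] (g : X ⟶ Spec (.of K)) [LocallyOfFiniteType g]
    (hfin : (Scheme.regularLocus X)ᶜ.Finite)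
    (hq : ∀ x : X, x ∉ Scheme.regularLocus X →
      ∃ (A : Type) (_ : AddCommGroup A) (_ : Finite A) (_ : DecidableEq A)
        (S : Type) (_ : CommRing S) (_ : Algebra K S) (𝒮 : A → Submodule K S)
        (_ : GradedAlgebra 𝒮), IsUnit ((Nat.card A : ℕ) : K) ∧ Algebra.FiniteType K S ∧
        IsRegularRing S ∧ ∃ φ : Spec (.of (𝒮 0)) ⟶ X, Etale φ ∧ x ∈ Set.range φ ∧
          φ ≫ g = Spec.map (CommRingCat.ofHom (algebraMap K (𝒮 0)))) :
    Scheme.HasResolution X := by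
  classical
  refine hasResolution_of_isolated_fixedPoint_charts_of_isAlgClosed K X g hfin fun x hx => ?_
  obtain ⟨A, _, _, _, S, _, _, 𝒮, _, htame, hft, hreg, φ, hφ, ⟨v, hv⟩, hφg⟩ := hq x hx
  haveI := hft
  haveI := hreg
  haveI := hφ
  obtain ⟨A', _, _, _, S', _, _, 𝒮', inst', hft', hreg', φ', hφ', -, v', 𝔔', h𝔔', h𝔔'v', hfix, hv'⟩ :=
    FixedChart.exists_fixed_chart K X g A S 𝒮 φ hφg htame v
  exact ⟨A', inferInstance, inferInstance, inferInstance, S', inferInstance, inferInstance, 𝒮', inst', hft', hreg',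
    φ', hφ', v', 𝔔', h𝔔', h𝔔'v', hfix, hv'.trans hv⟩

end Summit.ResolutionOfSingularities.ResolutionOfSingularities.Theorems.FRationalResolution.IsolatedFixedPointResolution

end

/-! ## Appendix (same generation): the tame SURFACE case over `K = K̄`, no local datum left

`…DiagQuotientSurface` (✓) reduced the surface slice of the stub to LOCAL resolutions at its finitely many closed singular
points and recorded, under `hq` verbatim and `dim X ≤ 2`, that the singular locus is FINITE
(`diagQuotient_surface_singularLocus`: `X` is normal by the regular-chart normality package; a normal surface has finitely
many singular points). Composed with `hasResolution_of_isolated_tame_quotient_charts_of_isAlgClosed` above this closes the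
`hloc` gap of `…DiagQuotientSurface.stub_diagonalizableQuotientResolution_of_surface_of_local` in the tame case over `K̄`.
[cite: Lipman1978, §2] [cite: Kato1994, (10.4)] -/

noncomputable section

-- single-problem summit: the doubled namespace component is forced
set_option linter.dupNamespace false

namespace Summit.ResolutionOfSingularities.ResolutionOfSingularities.Theorems.FRationalResolution.IsolatedFixedPointResolution

open CategoryTheory AlgebraicGeometry Literature.AlgebraicGeometry.Resolution
open Summit.ResolutionOfSingularities.ResolutionOfSingularities.Theorems.FRationalResolution

/-- **Tame diagonalizable quotient SURFACE singularities over `K = K̄` are resolvable.** Let `X` be an integral scheme of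
finite type over an algebraically closed field `K` with `dim X ≤ 2`, every point of which lies in the image of an étale
`K`-morphism `Spec S₀ → X` with `S` a REGULAR `K`-algebra of finite type graded by a finite abelian group `A` of order
invertible in `K`, `S₀ = 𝒮 0` (the stub's `hq` verbatim, tame). Then `X` has a resolution of singularities.
[cite: Kato1994, (10.4)] [cite: Lipman1978, §2] [cite: Kollar2007, §2.2] -/
theorem hasResolution_of_tame_quotient_surface_of_isAlgClosed (K : Type) [Field K] [IsAlgClosed K]
    (X : Scheme.{0}) (g : X ⟶ Spec (.of K)) [IsIntegral X] [LocallyOfFiniteType g] [QuasiCompact g]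
    (hq : ∀ x : X, ∃ (A : Type) (_ : AddCommGroup A) (_ : Finite A) (_ : DecidableEq A)
        (S : Type) (_ : CommRing S) (_ : Algebra K S) (𝒮 : A → Submodule K S)
        (_ : GradedAlgebra 𝒮), IsUnit ((Nat.card A : ℕ) : K) ∧ Algebra.FiniteType K S ∧
        IsRegularRing S ∧ ∃ φ : Spec (.of (𝒮 0)) ⟶ X, Etale φ ∧ x ∈ Set.range φ ∧
          φ ≫ g = Spec.map (CommRingCat.ofHom (algebraMap K (𝒮 0))))
    (hdim : topologicalKrullDim X ≤ 2) :
    Scheme.HasResolution X := by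
  have hq' : ∀ x : X, ∃ (A : Type) (_ : AddCommGroup A) (_ : Finite A) (_ : DecidableEq A)
      (S : Type) (_ : CommRing S) (_ : Algebra K S) (𝒮 : A → Submodule K S)
      (_ : GradedAlgebra 𝒮), Algebra.FiniteType K S ∧ IsRegularRing S ∧
      ∃ φ : Spec (.of (𝒮 0)) ⟶ X, Etale φ ∧ x ∈ Set.range φ ∧
        φ ≫ g = Spec.map (CommRingCat.ofHom (algebraMap K (𝒮 0))) := fun x => by
    obtain ⟨A, iA, fA, dA, S, iS, aS, 𝒮, gS, -, hft, hreg, φ, hφ, hx, hcomp⟩ := hq x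
    exact ⟨A, iA, fA, dA, S, iS, aS, 𝒮, gS, hft, hreg, φ, hφ, hx, hcomp⟩
  obtain ⟨hfin, -⟩ := DiagQuotientSurface.diagQuotient_surface_singularLocus K X g hq' hdim
  exact hasResolution_of_isolated_tame_quotient_charts_of_isAlgClosed K X g hfin fun x _ => hq x

end Summit.ResolutionOfSingularities.ResolutionOfSingularities.Theorems.FRationalResolution.IsolatedFixedPointResolution

end
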